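import Literature.Analysis.FluidPDE.NSLerayRegularisedLimit
import Mathlib.Analysis.SpecialFunctions.ImproperIntegrals
import Mathlib.MeasureTheory.Function.ConvergenceInMeasure
import HarnessLib

/-!
# Navier–Stokes on `E`: passage to the limit in a Leray regularised scheme — a jointly measurable
  representative of the limit field (proof of `NS.leray_regularised_limit`, part 2)

Trunk: FluidKinetic. Second module of the proof of `Literature.Analysis.FluidPDE.leray_regularised_limit`
(`Literature/Analysis/FluidPDE/NSLerayRegularised`), continuing
`Literature/Analysis/FluidPDE/NSLerayRegularisedLimit` (Steps 1–3 of Ożański–Pooley 2018, proof of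
Thm. 6.37). Theorem-only module apart from the auxiliary weighted field `NS.expWeighted`.

Leray's limit field is built **slice by slice** (`u t` = the weak `L²` limit of `U n t`, every
`t ≥ 0`), whereas the accepted weak formulation `Fluid.IsWeakNSSolutionOn` sees the honest function
`(t, x) ↦ u t x` and asks for its a.e. strong measurability on `(0, T) × E` — a property that
slice-wise information alone cannot give (the slices are only determined up to null sets). In print
this is invisible ("`u ∈ L^∞(0, T; L²)`", Ożański–Pooley 2018, Cor. 6.36; Leray 1934, §31 works with
functions measurable on `Π × (0, ∞)` throughout). This module supplies the representative:

* `IsLerayRegularisedScheme.tendsto_lintegral_expWeighted_sub`: once the slices converge strongly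
  at a.e. time (Step 3, `IsLerayRegularisedScheme.ae_tendsto_eLpNorm_sub`), the time-weighted
  space–time fields `W n (t, x) = e^{-t/2} U n t x` are Cauchy in `L²((0, ∞) × E)` (Tonelli and
  dominated convergence in time against `4 e^{-t} · 2E(u₀)`);
* `IsLerayRegularisedScheme.exists_subseq_tendsto_ae`: by completeness of `L²` and the
  a.e.-convergent subsequences of `L²`-convergent sequences, some subsequence `U (κ k)` converges at
  a.e. point of `(0, ∞) × E` to an a.e. strongly measurable space–time field `g`;
* `IsLerayRegularisedScheme.exists_measurable_sliceWeakLimit`: for a.e. `t` the slice `g (t, ·)`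
  is the `L²` limit `u t` (Fubini, and "`L²` limits are a.e. limits along a subsequence"); replacing
  `u t` by `g (t, ·)` off a measurable null set of times yields slice-wise weak limit data `u'`
  (`IsSliceWeakLimit U u₀ u'`, `u' t = u t` a.e. for every `t ≥ 0`, `u' 0 = u₀`) whose uncurried
  field is a.e. strongly measurable on `(0, ∞) × E` — it differs from `g` only on a product-null set
  — and hence on every strip `(0, T) × E` (`aestronglyMeasurable_uncurry_restrict_Ioo`).

## Mathlib search

Used: `MeasureTheory.lintegral_prod` (Tonelli), `tendsto_lintegral_filter_of_dominated_convergence'`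
(along `atTop` on `ℕ × ℕ`), `Filter.eventually_atTop_prod_self`, `cauchySeq_tendsto_of_complete` in
`MeasureTheory.Lp`, `Lp.tendsto_Lp_iff_tendsto_eLpNorm'`, `tendstoInMeasure_of_tendsto_eLpNorm`,
`TendstoInMeasure.exists_seq_tendsto_ae`, `Measure.ae_ae_of_ae_prod`,
`exists_measurable_superset_of_null`, `Measure.prod_prod`, `integrableOn_exp_neg_Ioi`. Mathlib has no
"measurable selection of representatives for a measurable family of `L²` classes" (searched
`StronglyMeasurable` + `Lp` + `uncurry`, `disintegration`): the weighted-Cauchy device above avoids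
it.

## References

* J. Leray, *Sur le mouvement d'un liquide visqueux emplissant l'espace*, Acta Math. 63 (1934),
  §§29–31 (the limit `U_i(x, t)` as a function on `Π × (0, ∞)`).
* W. S. Ożański, B. C. Pooley, *Leray's fundamental work on the Navier–Stokes equations*, LMS
  Lecture Note Ser. 452 (CUP 2018), proof of Thm. 6.37, Steps 3–4, Cor. 6.36.
-/

noncomputable section

open MeasureTheory TopologicalSpace Set Function Filter Topology ContinuousLinearMap
open scoped InnerProductSpace RealInnerProductSpace ENNReal NNReal Laplacian Convolution

namespace Literature.Analysis.FluidPDE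

variable {E : Type*} [NormedAddCommGroup E] [InnerProductSpace ℝ E] [FiniteDimensional ℝ E]
  [MeasurableSpace E] [BorelSpace E]

/-! ## A jointly measurable representative of the limit field -/

section Representative

variable {ν : ℝ} {u₀ : E → E} {φ : ℕ → ContDiffBump (0 : E)} {U : ℕ → ℝ → E → E}

/-- The product of Lebesgue measure on `(0, ∞)` with Lebesgue measure on `E` is the restriction of
the volume on `ℝ × E` to the half-space–time `(0, ∞) × E`. [folklore] -/
theorem prod_restrict_Ioi_volume :
    (volume.restrict (Ioi (0 : ℝ))).prod (volume : Measure E) =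
      (volume : Measure (ℝ × E)).restrict (Ioi 0 ×ˢ univ) := by
  conv_lhs => rw [← Measure.restrict_univ (μ := (volume : Measure E))]
  rw [Measure.prod_restrict]
  rfl

/-- The fields of a regularised scheme are a.e. strongly measurable on `(0, ∞) × E` (they are
continuous there). [folklore] -/
theorem IsLerayRegularisedScheme.aestronglyMeasurable_uncurry
    (hS : IsLerayRegularisedScheme ν u₀ φ U) (n : ℕ) :
    AEStronglyMeasurable (uncurry (U n)) ((volume.restrict (Ioi (0 : ℝ))).prod (volume : Measure E)) := by
  rw [prod_restrict_Ioi_volume]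
  exact ((hS.contDiffOn n).continuousOn).aestronglyMeasurable
    (measurableSet_Ioi.prod MeasurableSet.univ)

/-- Slice-wise weak limit data are insensitive to changing the slices on null sets (keeping the
slice at `t = 0`). [folklore] -/
theorem IsSliceWeakLimit.congr_ae {U : ℕ → ℝ → E → E} {u₀ : E → E} {u u' : ℝ → E → E}
    (h : IsSliceWeakLimit U u₀ u) (hae : ∀ t, 0 ≤ t → u' t =ᵐ[volume] u t) (h0 : u' 0 = u₀) :
    IsSliceWeakLimit U u₀ u' where
  memLp t ht := (h.memLp t ht).ae_eq (hae t ht).symm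
  isWeaklyDivFree t ht := (h.isWeaklyDivFree t ht).congr_ae (hae t ht).symm
  eLpNorm_le t ht := (eLpNorm_congr_ae (hae t ht)).trans_le (h.eLpNorm_le t ht)
  initial := h0
  tendsto t ht z hz := by
    have heq : ∫ x, ⟪u' t x, z x⟫ = ∫ x, ⟪u t x, z x⟫ :=
      integral_congr_ae (by filter_upwards [hae t ht] with x hx; rw [hx])
    rw [heq]
    exact h.tendsto t ht z hz

end Representative

section Weighted

variable {ν : ℝ} {u₀ : E → E} {φ : ℕ → ContDiffBump (0 : E)} {U : ℕ → ℝ → E → E}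

/-- The time-weighted space–time field `W n (t, x) = e^{-t/2} U n t x`, square integrable on
`(0, ∞) × E` uniformly in `n` (the weight makes the uniform-in-time `L²` bound integrable in
time); an auxiliary device for extracting an a.e.-convergent subsequence on all of `(0, ∞) × E` at
once. [folklore] -/
def expWeighted (U : ℕ → ℝ → E → E) (n : ℕ) (z : ℝ × E) : E :=
  Real.exp (-(z.1 / 2)) • U n z.1 z.2

omit [FiniteDimensional ℝ E] [MeasurableSpace E] [BorelSpace E] in
/-- Unfolding `expWeighted`. [folklore] -/
@[simp]
theorem expWeighted_apply (U : ℕ → ℝ → E → E) (n : ℕ) (z : ℝ × E) :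
    expWeighted U n z = Real.exp (-(z.1 / 2)) • U n z.1 z.2 := rfl

omit [FiniteDimensional ℝ E] [MeasurableSpace E] [BorelSpace E] in
/-- `‖e^{-t/2} v‖ₑ² = ofReal (e^{-t}) ‖v‖ₑ²`. [folklore] -/
theorem enorm_expWeighted_sub_sq (U : ℕ → ℝ → E → E) (n m : ℕ) (z : ℝ × E) :
    ‖expWeighted U n z - expWeighted U m z‖ₑ ^ 2 =
      ENNReal.ofReal (Real.exp (-z.1)) * ‖U n z.1 z.2 - U m z.1 z.2‖ₑ ^ 2 := by
  simp only [expWeighted_apply, ← smul_sub]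
  rw [enorm_smul, mul_pow, Real.enorm_eq_ofReal (Real.exp_pos _).le,
    ← ENNReal.ofReal_pow (Real.exp_pos _).le]
  congr 2
  rw [← Real.exp_nat_mul]
  congr 1
  push_cast
  ring

omit [FiniteDimensional ℝ E] [MeasurableSpace E] [BorelSpace E] in
/-- `‖e^{-t/2} v‖ₑ² = ofReal (e^{-t}) ‖v‖ₑ²`. [folklore] -/
theorem enorm_expWeighted_sq (U : ℕ → ℝ → E → E) (n : ℕ) (z : ℝ × E) :
    ‖expWeighted U n z‖ₑ ^ 2 = ENNReal.ofReal (Real.exp (-z.1)) * ‖U n z.1 z.2‖ₑ ^ 2 := by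
  rw [expWeighted_apply, enorm_smul, mul_pow, Real.enorm_eq_ofReal (Real.exp_pos _).le,
    ← ENNReal.ofReal_pow (Real.exp_pos _).le]
  congr 2
  rw [← Real.exp_nat_mul]
  congr 1
  push_cast
  ring

/-- `∫ ‖f − g‖ₑ² ≤ 2∫ ‖f − h‖ₑ² + 2∫ ‖g − h‖ₑ²` (through a third field `h`). [folklore] -/
theorem lintegral_enorm_sub_sq_le_two_mul {f g h : E → E}
    (hfh : AEStronglyMeasurable (fun x => f x - h x) (volume : Measure E)) :
    ∫⁻ x, ‖f x - g x‖ₑ ^ 2 ∂(volume : Measure E) ≤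
      2 * ∫⁻ x, ‖f x - h x‖ₑ ^ 2 ∂(volume : Measure E) +
        2 * ∫⁻ x, ‖g x - h x‖ₑ ^ 2 ∂(volume : Measure E) := by
  have hm : AEMeasurable (fun x => 2 * ‖f x - h x‖ₑ ^ 2) (volume : Measure E) :=
    (hfh.aemeasurable.enorm.pow_const 2).const_mul 2
  calc ∫⁻ x, ‖f x - g x‖ₑ ^ 2 ∂(volume : Measure E)
      ≤ ∫⁻ x, (2 * ‖f x - h x‖ₑ ^ 2 + 2 * ‖g x - h x‖ₑ ^ 2) := by
        refine lintegral_mono fun x => ?_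
        have h1 := enorm_sq_le_two_mul_sub_add (f x - g x) (h x - g x)
        have e1 : f x - g x - (h x - g x) = f x - h x := by abel
        have e2 : ‖h x - g x‖ₑ = ‖g x - h x‖ₑ := by rw [← enorm_neg, neg_sub]
        rwa [e1, e2] at h1
    _ = 2 * ∫⁻ x, ‖f x - h x‖ₑ ^ 2 ∂(volume : Measure E) +
          2 * ∫⁻ x, ‖g x - h x‖ₑ ^ 2 ∂(volume : Measure E) := by
        rw [lintegral_add_left' hm, lintegral_const_mul' _ _ ENNReal.ofNat_ne_top,
          lintegral_const_mul' _ _ ENNReal.ofNat_ne_top]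

/-- The weighted fields are a.e. strongly measurable on `(0, ∞) × E`. [folklore] -/
theorem IsLerayRegularisedScheme.aestronglyMeasurable_expWeighted
    (hS : IsLerayRegularisedScheme ν u₀ φ U) (n : ℕ) :
    AEStronglyMeasurable (expWeighted U n)
      ((volume.restrict (Ioi (0 : ℝ))).prod (volume : Measure E)) := by
  have hc : Continuous fun z : ℝ × E => Real.exp (-(z.1 / 2)) := by fun_prop
  exact hc.aestronglyMeasurable.smul (hS.aestronglyMeasurable_uncurry n)

/-- **The weighted fields are Cauchy in `L²((0, ∞) × E)`** once the slices converge strongly at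
a.e. time: `‖W n − W m‖² = ∫₀^∞ e^{-t} ‖U n t − U m t‖₂² dt → 0` as `n, m → ∞` (Tonelli and dominated
convergence in time, with the bound `4 e^{-t} · 2E(u₀)`). [folklore] -/
theorem IsLerayRegularisedScheme.tendsto_lintegral_expWeighted_sub
    (hS : IsLerayRegularisedScheme ν u₀ φ U) (hν : 0 < ν) (hu₀ : MemLp u₀ 2 volume)
    {u : ℝ → E → E} (hW : IsSliceWeakLimit U u₀ u)
    (hae : ∀ᵐ t ∂(volume.restrict (Ioi (0 : ℝ))),
      Tendsto (fun n => eLpNorm (U n t - u t) 2 volume) atTop (𝓝 0)) :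
    Tendsto (fun p : ℕ × ℕ => ∫⁻ z, ‖expWeighted U p.1 z - expWeighted U p.2 z‖ₑ ^ 2
      ∂((volume.restrict (Ioi (0 : ℝ))).prod (volume : Measure E))) atTop (𝓝 0) := by
  set μt : Measure ℝ := volume.restrict (Ioi (0 : ℝ)) with hμt
  -- the slice distances and their bound
  set D : ℕ × ℕ → ℝ → ℝ≥0∞ := fun p t =>
    ∫⁻ x, ‖expWeighted U p.1 (t, x) - expWeighted U p.2 (t, x)‖ₑ ^ 2 with hD
  have hDm : ∀ p, AEMeasurable (D p) μt := fun p => by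
    have h := ((hS.aestronglyMeasurable_expWeighted p.1).sub
      (hS.aestronglyMeasurable_expWeighted p.2)).aemeasurable.enorm.pow_const 2
    exact h.lintegral_prod_right'
  have hfub : ∀ p : ℕ × ℕ, ∫⁻ z, ‖expWeighted U p.1 z - expWeighted U p.2 z‖ₑ ^ 2
      ∂(μt.prod (volume : Measure E)) = ∫⁻ t, D p t ∂μt := fun p =>
    lintegral_prod _ (((hS.aestronglyMeasurable_expWeighted p.1).sub
      (hS.aestronglyMeasurable_expWeighted p.2)).aemeasurable.enorm.pow_const 2)
  simp_rw [hfub]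
  set K : ℝ≥0∞ := FluidPDE.eEnergy u₀ with hK
  have hKtop : K ≠ ∞ := by
    rw [hK, FluidPDE.eEnergy_eq_ofReal u₀ hu₀]; exact ENNReal.ofReal_ne_top
  -- `D p t ≤ ofReal (e^{-t}) * 4K` for `t > 0`
  have hslice : ∀ n t, 0 < t → ∫⁻ x, ‖U n t x‖ₑ ^ 2 ∂(volume : Measure E) ≤ K := fun n t ht =>
    hS.eEnergy_le hν.le hu₀ n ht.le
  have hbound : ∀ p, ∀ᵐ t ∂μt, D p t ≤ ENNReal.ofReal (Real.exp (-t)) * (4 * K) := by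
    intro p
    filter_upwards [ae_restrict_mem (measurableSet_Ioi : MeasurableSet (Ioi (0 : ℝ)))] with t ht
    have ht' : 0 < t := ht
    rw [hD]
    simp only [enorm_expWeighted_sub_sq]
    rw [lintegral_const_mul' _ _ ENNReal.ofReal_ne_top]
    gcongr
    have hm : AEStronglyMeasurable (fun x => U p.1 t x - (0 : E → E) x) (volume : Measure E) := by
      simpa using (hS.memLp p.1 ht'.le).1
    calc ∫⁻ x, ‖U p.1 t x - U p.2 t x‖ₑ ^ 2 ∂(volume : Measure E)
        ≤ 2 * ∫⁻ x, ‖U p.1 t x - (0 : E → E) x‖ₑ ^ 2 ∂(volume : Measure E) +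
            2 * ∫⁻ x, ‖U p.2 t x - (0 : E → E) x‖ₑ ^ 2 ∂(volume : Measure E) :=
          lintegral_enorm_sub_sq_le_two_mul hm
      _ ≤ 2 * K + 2 * K := by
          simp only [Pi.zero_apply, sub_zero]
          exact add_le_add (mul_le_mul_right (hslice p.1 t ht') 2)
            (mul_le_mul_right (hslice p.2 t ht') 2)
      _ = 4 * K := by ring
  -- the bound is integrable: `∫₀^∞ e^{-t} = 1`
  have hfin : ∫⁻ t, ENNReal.ofReal (Real.exp (-t)) * (4 * K) ∂μt ≠ ∞ := by
    rw [lintegral_mul_const' _ _ (ENNReal.mul_ne_top ENNReal.ofNat_ne_top hKtop)]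
    refine ENNReal.mul_ne_top ?_ (ENNReal.mul_ne_top ENNReal.ofNat_ne_top hKtop)
    rw [hμt, ← ofReal_integral_eq_lintegral_ofReal (integrableOn_exp_neg_Ioi 0)
      (ae_of_all _ fun t => (Real.exp_pos _).le)]
    exact ENNReal.ofReal_ne_top
  -- pointwise convergence at the good times
  have hlim : ∀ᵐ t ∂μt, Tendsto (fun p => D p t) atTop (𝓝 0) := by
    filter_upwards [hae, ae_restrict_mem (measurableSet_Ioi : MeasurableSet (Ioi (0 : ℝ)))]
      with t ht htpos
    -- `∫ ‖U n t - u t‖ₑ² → 0`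
    have hd : Tendsto (fun n => ∫⁻ x, ‖U n t x - u t x‖ₑ ^ 2 ∂(volume : Measure E)) atTop (𝓝 0) := by
      have h2 : Tendsto (fun n => eLpNorm (U n t - u t) 2 (volume : Measure E) ^ (2 : ℝ)) atTop
          (𝓝 0) := by
        have := ((ENNReal.continuous_rpow_const (y := (2 : ℝ))).tendsto 0).comp ht
        simpa [Function.comp_def, ENNReal.zero_rpow_of_pos (show (0 : ℝ) < 2 by norm_num)]
          using this
      refine h2.congr fun n => ?_
      rw [eLpNorm_eq_lintegral_rpow_enorm_toReal two_ne_zero ENNReal.ofNat_ne_top,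
        ENNReal.toReal_ofNat, ← ENNReal.rpow_mul]
      norm_num
    have hfst : Tendsto (fun p : ℕ × ℕ => p.1) atTop atTop :=
      tendsto_atTop_atTop.2 fun b => ⟨(b, b), fun p hp => hp.1⟩
    have hsnd : Tendsto (fun p : ℕ × ℕ => p.2) atTop atTop :=
      tendsto_atTop_atTop.2 fun b => ⟨(b, b), fun p hp => hp.2⟩
    have hsum : Tendsto (fun p : ℕ × ℕ => ENNReal.ofReal (Real.exp (-t)) *
        (2 * ∫⁻ x, ‖U p.1 t x - u t x‖ₑ ^ 2 ∂(volume : Measure E) +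
          2 * ∫⁻ x, ‖U p.2 t x - u t x‖ₑ ^ 2 ∂(volume : Measure E))) atTop (𝓝 0) := by
      have h2top : (2 : ℝ≥0∞) ≠ ∞ := ENNReal.ofNat_ne_top
      have h := (ENNReal.Tendsto.const_mul (a := 2) (hd.comp hfst) (Or.inr h2top)).add
        (ENNReal.Tendsto.const_mul (a := 2) (hd.comp hsnd) (Or.inr h2top))
      simp only [mul_zero, add_zero] at h
      have h' := ENNReal.Tendsto.const_mul (a := ENNReal.ofReal (Real.exp (-t))) h
        (Or.inr ENNReal.ofReal_ne_top)
      simpa using h'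
    refine tendsto_of_tendsto_of_tendsto_of_le_of_le tendsto_const_nhds hsum
      (fun _ => bot_le) (fun p => ?_)
    rw [hD]
    simp only [enorm_expWeighted_sub_sq]
    rw [lintegral_const_mul' _ _ ENNReal.ofReal_ne_top]
    gcongr
    exact lintegral_enorm_sub_sq_le_two_mul
      ((hS.memLp p.1 htpos.le).sub (hW.memLp t htpos.le)).1
  have h := tendsto_lintegral_filter_of_dominated_convergence' (l := (atTop : Filter (ℕ × ℕ)))
    (fun t => ENNReal.ofReal (Real.exp (-t)) * (4 * K)) (Eventually.of_forall hDm)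
    (Eventually.of_forall hbound) hfin hlim
  simpa using h

end Weighted

section Subsequence

variable {ν : ℝ} {u₀ : E → E} {φ : ℕ → ContDiffBump (0 : E)} {U : ℕ → ℝ → E → E}

/-- The weighted fields are in `L²((0, ∞) × E)`: `‖W n‖² = ∫₀^∞ e^{-t}‖U n t‖₂² ≤ 2E(u₀)`. [folklore] -/
theorem IsLerayRegularisedScheme.memLp_expWeighted
    (hS : IsLerayRegularisedScheme ν u₀ φ U) (hν : 0 < ν) (hu₀ : MemLp u₀ 2 volume) (n : ℕ) :
    MemLp (expWeighted U n) 2 ((volume.restrict (Ioi (0 : ℝ))).prod (volume : Measure E)) := by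
  set μt : Measure ℝ := volume.restrict (Ioi (0 : ℝ)) with hμt
  have hm := hS.aestronglyMeasurable_expWeighted n
  refine ⟨hm, ?_⟩
  rw [eLpNorm_eq_lintegral_rpow_enorm_toReal two_ne_zero ENNReal.ofNat_ne_top]
  norm_num only [ENNReal.toReal_ofNat]
  refine ENNReal.rpow_lt_top_of_nonneg (by norm_num) (ne_of_lt ?_)
  have hmeas : AEMeasurable (fun z => ‖expWeighted U n z‖ₑ ^ (2 : ℝ)) (μt.prod (volume : Measure E)) :=
    hm.aemeasurable.enorm.pow_const _
  rw [lintegral_prod _ hmeas]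
  set K : ℝ≥0∞ := FluidPDE.eEnergy u₀ with hK
  have hKtop : K ≠ ∞ := by
    rw [hK, FluidPDE.eEnergy_eq_ofReal u₀ hu₀]; exact ENNReal.ofReal_ne_top
  calc ∫⁻ t, ∫⁻ x, ‖expWeighted U n (t, x)‖ₑ ^ (2 : ℝ) ∂(volume : Measure E) ∂μt
      ≤ ∫⁻ t, ENNReal.ofReal (Real.exp (-t)) * K ∂μt := by
        refine lintegral_mono_ae ?_
        filter_upwards [ae_restrict_mem (measurableSet_Ioi : MeasurableSet (Ioi (0 : ℝ)))] with t ht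
        have ht' : 0 < t := ht
        simp only [ENNReal.rpow_two, enorm_expWeighted_sq]
        rw [lintegral_const_mul' _ _ ENNReal.ofReal_ne_top]
        gcongr
        exact hS.eEnergy_le hν.le hu₀ n ht'.le
    _ = (∫⁻ t, ENNReal.ofReal (Real.exp (-t)) ∂μt) * K := lintegral_mul_const' _ _ hKtop
    _ < ∞ := by
        refine ENNReal.mul_lt_top ?_ hKtop.lt_top
        rw [hμt, ← ofReal_integral_eq_lintegral_ofReal (integrableOn_exp_neg_Ioi 0)
          (ae_of_all _ fun t => (Real.exp_pos _).le)]
        exact ENNReal.ofReal_lt_top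

/-- **An a.e.-convergent subsequence on the whole half-space–time.** If the slices converge
strongly at a.e. time, some subsequence `U (κ k)` converges at a.e. point of `(0, ∞) × E` to an
a.e. strongly measurable space–time field `g` (the weighted fields are Cauchy in the complete space
`L²((0, ∞) × E)`, and `L²` limits have a.e.-convergent subsequences). [folklore] -/
theorem IsLerayRegularisedScheme.exists_subseq_tendsto_ae
    (hS : IsLerayRegularisedScheme ν u₀ φ U) (hν : 0 < ν) (hu₀ : MemLp u₀ 2 volume)
    {u : ℝ → E → E} (hW : IsSliceWeakLimit U u₀ u)
    (hae : ∀ᵐ t ∂(volume.restrict (Ioi (0 : ℝ))),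
      Tendsto (fun n => eLpNorm (U n t - u t) 2 volume) atTop (𝓝 0)) :
    ∃ (κ : ℕ → ℕ) (g : ℝ × E → E), StrictMono κ ∧
      AEStronglyMeasurable g ((volume.restrict (Ioi (0 : ℝ))).prod (volume : Measure E)) ∧
      ∀ᵐ z ∂((volume.restrict (Ioi (0 : ℝ))).prod (volume : Measure E)),
        Tendsto (fun k => U (κ k) z.1 z.2) atTop (𝓝 (g z)) := by
  set μ : Measure (ℝ × E) := (volume.restrict (Ioi (0 : ℝ))).prod (volume : Measure E) with hμ
  have hmem : ∀ n, MemLp (expWeighted U n) 2 μ := fun n => hS.memLp_expWeighted hν hu₀ n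
  let Wn : ℕ → Lp E 2 μ := fun n => (hmem n).toLp (expWeighted U n)
  -- `Wn` is Cauchy
  have hpair : Tendsto (fun p : ℕ × ℕ => dist (Wn p.1) (Wn p.2)) atTop (𝓝 0) := by
    have h0 := hS.tendsto_lintegral_expWeighted_sub hν hu₀ hW hae
    have h1 : Tendsto (fun p : ℕ × ℕ => (∫⁻ z, ‖expWeighted U p.1 z - expWeighted U p.2 z‖ₑ ^ 2 ∂μ)
        ^ (1 / 2 : ℝ)) atTop (𝓝 0) := by
      have := ((ENNReal.continuous_rpow_const (y := (1 / 2 : ℝ))).tendsto 0).comp h0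
      simpa [Function.comp_def, ENNReal.zero_rpow_of_pos (show (0 : ℝ) < 1 / 2 by norm_num)]
        using this
    have h2 : ∀ p : ℕ × ℕ, dist (Wn p.1) (Wn p.2) =
        ((∫⁻ z, ‖expWeighted U p.1 z - expWeighted U p.2 z‖ₑ ^ 2 ∂μ) ^ (1 / 2 : ℝ)).toReal := by
      intro p
      simp only [Wn]
      rw [Lp.dist_def, eLpNorm_congr_ae (((hmem p.1).coeFn_toLp).sub ((hmem p.2).coeFn_toLp)),
        eLpNorm_eq_lintegral_rpow_enorm_toReal two_ne_zero ENNReal.ofNat_ne_top]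
      norm_num only [ENNReal.toReal_ofNat, Pi.sub_apply, ENNReal.rpow_ofNat]
    simp_rw [h2]
    rw [← ENNReal.toReal_zero]
    exact (ENNReal.tendsto_toReal ENNReal.zero_ne_top).comp h1
  have hcauchy : CauchySeq Wn := by
    rw [Metric.cauchySeq_iff]
    intro ε hε
    obtain ⟨N, hN⟩ := eventually_atTop_prod_self.1 (hpair.eventually (gt_mem_nhds hε))
    exact ⟨N, fun m hm n hn => hN m n hm hn⟩
  obtain ⟨Wlim, hWlim⟩ := cauchySeq_tendsto_of_complete hcauchy
  -- convergence in measure of the weighted functions, and an a.e.-convergent subsequence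
  have hin : TendstoInMeasure μ (fun n => expWeighted U n) atTop (Wlim : ℝ × E → E) := by
    refine tendstoInMeasure_of_tendsto_eLpNorm two_ne_zero (fun n => (hmem n).1)
      (Lp.aestronglyMeasurable Wlim) ?_
    have h := (Lp.tendsto_Lp_iff_tendsto_eLpNorm' Wn Wlim).1 hWlim
    refine h.congr fun n => eLpNorm_congr_ae ?_
    filter_upwards [(hmem n).coeFn_toLp] with z hz
    simp only [Pi.sub_apply, hz, Wn]
  obtain ⟨κ, hκ, hconv⟩ := hin.exists_seq_tendsto_ae
  refine ⟨κ, fun z => Real.exp (z.1 / 2) • (Wlim : ℝ × E → E) z, hκ, ?_, ?_⟩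
  · have hc : Continuous fun z : ℝ × E => Real.exp (z.1 / 2) := by fun_prop
    exact hc.aestronglyMeasurable.smul (Lp.aestronglyMeasurable Wlim)
  · filter_upwards [hconv] with z hz
    have hU : ∀ k, U (κ k) z.1 z.2 = Real.exp (z.1 / 2) • expWeighted U (κ k) z := fun k => by
      rw [expWeighted_apply, smul_smul, ← Real.exp_add]
      simp
    simp_rw [hU]
    exact hz.const_smul _

end Subsequence

section MeasurableRepresentative

variable {ν : ℝ} {u₀ : E → E} {φ : ℕ → ContDiffBump (0 : E)} {U : ℕ → ℝ → E → E}

/-- `L²` limits and a.e. limits agree: if `U k → w` in `L²(E)` and `U k x → g x` for a.e. `x`, then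
`w = g` a.e. [folklore] -/
theorem ae_eq_of_tendsto_eLpNorm_of_tendsto_ae {Uk : ℕ → E → E} {w g : E → E}
    (hU : ∀ k, AEStronglyMeasurable (Uk k) (volume : Measure E))
    (hw : AEStronglyMeasurable w (volume : Measure E))
    (hL2 : Tendsto (fun k => eLpNorm (Uk k - w) 2 (volume : Measure E)) atTop (𝓝 0))
    (hpt : ∀ᵐ x ∂(volume : Measure E), Tendsto (fun k => Uk k x) atTop (𝓝 (g x))) :
    w =ᵐ[volume] g := by
  have hin : TendstoInMeasure volume Uk atTop w := tendstoInMeasure_of_tendsto_eLpNorm two_ne_zero hU hw hL2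
  obtain ⟨ns, hns, hae⟩ := hin.exists_seq_tendsto_ae
  filter_upwards [hae, hpt] with x h1 h2
  exact tendsto_nhds_unique h1 (h2.comp hns.tendsto_atTop)

/-- **A jointly measurable representative of the limit field** (the technical point behind
"`u ∈ L²_loc((0, T) × E)`" for a field assembled slice by slice from weak limits). If the slices of
a regularised scheme converge strongly at a.e. time to slice-wise weak limit data `u`, then there are
slice-wise weak limit data `u'` with `u' t = u t` a.e. for every `t ≥ 0` (so all slice properties and
convergences transfer) such that `(t, x) ↦ u' t x` is a.e. strongly measurable on `(0, ∞) × E`: off a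
null set of times, `u' t` is the slice of the a.e. limit `g` of an a.e.-convergent subsequence on
`(0, ∞) × E` (`exists_subseq_tendsto_ae`), which agrees a.e. with the `L²` limit `u t`. [folklore] -/
theorem IsLerayRegularisedScheme.exists_measurable_sliceWeakLimit
    (hS : IsLerayRegularisedScheme ν u₀ φ U) (hν : 0 < ν) (hu₀ : MemLp u₀ 2 volume)
    {u : ℝ → E → E} (hW : IsSliceWeakLimit U u₀ u)
    (hae : ∀ᵐ t ∂(volume.restrict (Ioi (0 : ℝ))),
      Tendsto (fun n => eLpNorm (U n t - u t) 2 volume) atTop (𝓝 0)) :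
    ∃ u' : ℝ → E → E, IsSliceWeakLimit U u₀ u' ∧ (∀ t, 0 ≤ t → u' t =ᵐ[volume] u t) ∧
      AEStronglyMeasurable (uncurry u') ((volume.restrict (Ioi (0 : ℝ))).prod (volume : Measure E)) := by
  classical
  set μt : Measure ℝ := volume.restrict (Ioi (0 : ℝ)) with hμt
  obtain ⟨κ, g, hκ, hg, hconv⟩ := hS.exists_subseq_tendsto_ae hν hu₀ hW hae
  -- for a.e. `t`, the slice of `g` is the `L²` limit `u t`
  have h1 : ∀ᵐ t ∂μt, ∀ᵐ x ∂(volume : Measure E), Tendsto (fun k => U (κ k) t x) atTop (𝓝 (g (t, x))) :=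
    Measure.ae_ae_of_ae_prod hconv
  have hgood : ∀ᵐ t ∂μt, u t =ᵐ[volume] fun x => g (t, x) := by
    filter_upwards [h1, hae, ae_restrict_mem (measurableSet_Ioi : MeasurableSet (Ioi (0 : ℝ)))]
      with t ht1 ht2 ht3
    have ht3' : 0 < t := ht3
    exact ae_eq_of_tendsto_eLpNorm_of_tendsto_ae (fun k => (hS.memLp (κ k) ht3'.le).1)
      (hW.memLp t ht3'.le).1 (ht2.comp hκ.tendsto_atTop) ht1
  -- a measurable null set of times containing the bad ones
  obtain ⟨N, hNsub, hNmeas, hNnull⟩ :=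
    exists_measurable_superset_of_null (s := {t | ¬ (u t =ᵐ[volume] fun x => g (t, x))})
      (μ := μt) (ae_iff.1 hgood)
  -- the modified field
  let u' : ℝ → E → E := fun t => if t ∈ N ∨ t ≤ 0 then u t else fun x => g (t, x)
  have hslice : ∀ t, 0 ≤ t → u' t =ᵐ[volume] u t := by
    intro t ht
    by_cases h : t ∈ N ∨ t ≤ 0
    · simp [u', h]
    · have hnot : u t =ᵐ[volume] fun x => g (t, x) := by
        by_contra hc
        exact h (Or.inl (hNsub hc))
      simp only [u', if_neg h]
      exact hnot.symm
  have h0 : u' 0 = u₀ := by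
    simp only [u', le_refl, or_true, if_true]
    exact hW.initial
  refine ⟨u', hW.congr_ae hslice h0, hslice, ?_⟩
  -- joint measurability: `uncurry u' = g` off `(N ∪ Iic 0) × E`, a null set
  have hnull : (μt.prod (volume : Measure E)) ((N ∪ Iic 0) ×ˢ (univ : Set E)) = 0 := by
    rw [Measure.prod_prod]
    have : μt (N ∪ Iic 0) = 0 := by
      refine le_antisymm ((measure_union_le _ _).trans ?_) bot_le
      rw [hNnull, zero_add, hμt, Measure.restrict_apply measurableSet_Iic]
      have : Iic (0 : ℝ) ∩ Ioi 0 = ∅ := by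
        ext t; simp only [mem_inter_iff, mem_Iic, mem_Ioi, mem_empty_iff_false, iff_false, not_and,
          not_lt]; exact fun h => h
      rw [this, measure_empty]
    rw [this, zero_mul]
  have heq : uncurry u' =ᵐ[μt.prod (volume : Measure E)] g := by
    rw [Filter.EventuallyEq, ae_iff]
    refine measure_mono_null (fun z hz => ?_) hnull
    simp only [mem_setOf_eq] at hz
    refine ⟨?_, mem_univ _⟩
    by_contra hc
    have hc' : ¬ (z.1 ∈ N ∨ z.1 ≤ 0) := by simpa [mem_union, mem_Iic] using hc
    apply hz
    show (if z.1 ∈ N ∨ z.1 ≤ 0 then u z.1 else fun x => g (z.1, x)) z.2 = g z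
    rw [if_neg hc']
  exact hg.congr heq.symm

/-- The measurable representative is a.e. strongly measurable on every finite strip
`(0, T) × E` for the volume — the measurability clause of `Fluid.IsWeakNSSolutionOn`. [folklore] -/
theorem aestronglyMeasurable_uncurry_restrict_Ioo {u' : ℝ → E → E}
    (h : AEStronglyMeasurable (uncurry u') ((volume.restrict (Ioi (0 : ℝ))).prod (volume : Measure E)))
    (T : ℝ) : AEStronglyMeasurable (uncurry u') (volume.restrict (Ioo 0 T ×ˢ (univ : Set E))) := by
  rw [prod_restrict_Ioi_volume] at h
  exact h.mono_measure (Measure.restrict_mono (prod_mono Ioo_subset_Ioi_self subset_rfl) le_rfl)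

end MeasurableRepresentative

end Literature.Analysis.FluidPDE
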